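import Literature.NumberTheory.Sieve.IntervalResidueClassSieve
import Literature.NumberTheory.Sieve.PolynomialValuesSieveSequence

/-!
# The sifted polynomial progression `#{n ≤ N : c ∣ g(n), p ∤ g(n) (p < u, p ∤ c)}`

Solo informed line (Parity / Bateman–Horn), session 138 — the first file of the discharge of the
Nair–Tenenbaum hypothesis of `SoloInformedErdosUpperBoundNT` (Erdős's bound
`∑_{n ≤ x} τ(|g(n)|) ≪ x log x`, J. London Math. Soc. 27 (1952)).  In Shiu's decomposition
`|g(n)| = c_n · d_n` (`c_n` the largest initial segment `≤ z` of the factorisation, `d_n` free of the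
primes below the cut prime) the classes I and IV are counted by the polynomial analogue of Shiu's
Lemma 2 (the sifted segment of a progression): for `c ≥ 1`, `u ≥ 2` and every `N`,

  `#{1 ≤ n ≤ N : c ∣ g(n), p ∤ g(n) for every prime p < u with p ∤ c}`
    `≤ C(D) · ρ_g(c) · ((N/c + 1) · ∏_{p < u, p ∤ c} (1 − ρ_g(p)/p) + u²)`,

uniformly in `g ∈ ℤ[X]` with `ρ_g(p) ≤ D` and `ρ_g(p) < p` at every prime
(`ρ_g(m) = polyRootCountMod ![g] m`, the number of roots of `g` modulo `m`).  Everything is PROVED from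
the tree's fundamental lemma for an interval sifted by prescribed residue classes
(`IntervalClassSieve.abs_card_sub_le`, itself from the PROVED uniform Fundamental Lemma
`SieveSequence.fundamental_lemma_uniform_holds`):

* `card_filter_range_dvd_eval_affine` — for a prime `p ∤ c` and any `s`, the map `t ↦ g(s + c t)` has
  exactly `ρ_g(p)` roots modulo `p` (`t ↦ s + c t` permutes the residues modulo `p`);
* `card_Icc_filter_dvd_eval_le` — `#{1 ≤ n ≤ N : c ∣ g(n)} ≤ ρ_g(c) · (N/c + 1)` (the `ρ_g(c)` root
  classes modulo `c`, each met at most `N/c + 1` times in `[1, N]`);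
* `card_fiber_sifted_le` — in ONE class `n ≡ s (mod c)` the map `n ↦ ⌊n/c⌋` sends the sifted `n` into
  `{0} ∪ {1 ≤ t ≤ N/c : t mod p ∉ Ω_p for all p < u}` with `Ω_p` the roots of `g(s + c ·)` modulo `p`
  for `p ∤ c` and `Ω_p = ∅` for `p ∣ c` (`#Ω_p = ρ_g(p) ≤ D`, `#Ω_p < p`), which the interval sieve
  counts;
* `polySegment_sieve_bound` — the displayed bound with `C(D) = 2 + C_FL(D)`, summed over the root
  classes; `prod_filter_not_dvd_le` and `polySegment_sieve_bound'` — the same bound with the product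
  split as `∏_{p < u} (1 − ρ_g(p)/p) · ∏_{p ∣ c} (1 − ρ_g(p)/p)⁻¹`, the shape that is summed over `c`
  with multiplicative weights in Shiu's classes I and IV.

No definitions, no named facts, no hypotheses beyond the data.

References: P. Shiu, J. reine angew. Math. 313 (1980) 161–170, Lemma 2 [Shiu1980]; M. Nair,
Acta Arith. 62 (1992) 257–269 [Nair1992]; M. Nair, G. Tenenbaum, Acta Math. 180 (1998) 119–144
[NairTenenbaum1998]; P. Erdős, J. London Math. Soc. 27 (1952) 7–15 [Erdos1952]; H. Halberstam,
H.-E. Richert, *Sieve Methods* (1974), Thm 2.5 [HalberstamRichert1974].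
-/

open Finset Real Polynomial

namespace Summit.Parity.BatemanHorn.Theorems

open Literature.NumberTheory.Sieve

namespace ErdosDivisor

/-! ### Root classes under an affine substitution -/

/-- For a prime `p ∤ c` and any `s`, the number of residues `t mod p` with `p ∣ g(s + c t)` is
`ρ_g(p)`: the map `t ↦ (s + c t) mod p` is injective on `{0, …, p − 1}`, hence bijective, and
`p ∣ g(m) ↔ p ∣ g(m mod p)`. [folklore] -/
theorem card_filter_range_dvd_eval_affine (g : ℤ[X]) {p : ℕ} (hp : p.Prime) {c : ℕ} (hpc : ¬ p ∣ c)
    (s : ℕ) :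
    #((range p).filter fun t : ℕ => (p : ℤ) ∣ g.eval ((s : ℤ) + c * t)) = polyRootCountMod ![g] p := by
  rw [polyRootCountMod_single]
  have hcop : Nat.Coprime p c := (Nat.Prime.coprime_iff_not_dvd hp).2 hpc
  have hmod : ∀ t : ℕ, (p : ℤ) ∣ g.eval ((s : ℤ) + c * t) ↔
      (p : ℤ) ∣ g.eval (((s + c * t) % p : ℕ) : ℤ) := by
    intro t
    have h := dvd_eval_iff_dvd_eval_mod g p (s + c * t)
    push_cast at h
    exact h
  have hinj : ∀ t₁ ∈ range p, ∀ t₂ ∈ range p, (s + c * t₁) % p = (s + c * t₂) % p → t₁ = t₂ := by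
    intro t₁ ht₁ t₂ ht₂ h
    have h1 : c * t₁ ≡ c * t₂ [MOD p] := Nat.ModEq.add_left_cancel' s h
    exact Nat.ModEq.eq_of_lt_of_lt (Nat.ModEq.cancel_left_of_coprime hcop h1)
      (mem_range.1 ht₁) (mem_range.1 ht₂)
  refine card_bij (fun t _ => (s + c * t) % p) ?_ ?_ ?_
  · intro t ht
    obtain ⟨-, hdvd⟩ := mem_filter.1 ht
    exact mem_filter.2 ⟨mem_range.2 (Nat.mod_lt _ hp.pos), (hmod t).1 hdvd⟩
  · intro t₁ ht₁ t₂ ht₂ h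
    exact hinj t₁ (mem_filter.1 ht₁).1 t₂ (mem_filter.1 ht₂).1 h
  · intro n hn
    obtain ⟨hnp, hdvd⟩ := mem_filter.1 hn
    obtain ⟨t, ht, hnt⟩ := surj_on_of_inj_on_of_card_le (s := range p) (t := range p)
      (fun t _ => (s + c * t) % p) (fun t _ => mem_range.2 (Nat.mod_lt _ hp.pos))
      (fun t₁ t₂ ht₁ ht₂ h => hinj t₁ ht₁ t₂ ht₂ h) le_rfl n hnp
    refine ⟨t, mem_filter.2 ⟨ht, (hmod t).2 ?_⟩, hnt.symm⟩
    rw [← hnt]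
    exact hdvd

/-! ### Divisibility classes -/

/-- **Polynomial congruence classes in `[1, N]`**: `#{1 ≤ n ≤ N : c ∣ g(n)} ≤ ρ_g(c) · (N/c + 1)`
(split into the `ρ_g(c)` root classes modulo `c`, `card_filter_dvd_eval_eq_sum`, each met at most
`N/c + 1` times, `card_apIndex_le`). [folklore] -/
theorem card_Icc_filter_dvd_eval_le (g : ℤ[X]) {c : ℕ} (hc : 0 < c) (N : ℕ) :
    (#((Icc 1 N).filter fun n : ℕ => (c : ℤ) ∣ g.eval (n : ℤ)) : ℝ) ≤
      polyRootCountMod ![g] c * ((N : ℝ) / c + 1) := by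
  rw [card_filter_dvd_eval_eq_sum g (Icc 1 N) hc, polyRootCountMod_single]
  push_cast
  calc ∑ s ∈ (range c).filter (fun s : ℕ => (c : ℤ) ∣ g.eval (s : ℤ)),
        (#((Icc 1 N).filter fun n : ℕ => n ≡ s [MOD c]) : ℝ)
      ≤ ∑ s ∈ (range c).filter (fun s : ℕ => (c : ℤ) ∣ g.eval (s : ℤ)), ((N : ℝ) / c + 1) :=
        sum_le_sum fun s _ => by
          rw [show Icc 1 N = Ioc 0 N from by
            ext n; simp [Nat.one_le_iff_ne_zero, Nat.pos_iff_ne_zero]]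
          simpa only [apIndex] using card_apIndex_le hc N s
    _ = _ := by rw [sum_const, nsmul_eq_mul]

/-! ### One root class, sifted -/

/-- **One class of the sifted polynomial progression.**  Given the interval sieve for `≤ D` classes
per prime with constant `C₀` (the conclusion of `IntervalClassSieve.abs_card_sub_le D`), a polynomial
`g` with `ρ_g(p) ≤ D`, `ρ_g(p) < p` at every prime, `c ≥ 1`, a residue `s` and `u ≥ 2`:
`#{1 ≤ n ≤ N : n mod c = s, p ∤ g(n) ∀ p < u prime with p ∤ c}`
`≤ (1 + C₀) (N/c) ∏_{p<u, p∤c} (1 − ρ_g(p)/p) + u² + 1`.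
Proof: `n ↦ ⌊n/c⌋` is injective on the class and lands in `{0} ∪ {1 ≤ t ≤ ⌊N/c⌋ : t mod p ∉ Ω_p}`
where, writing `n = s + c t`, `Ω_p = {t mod p : p ∣ g(s + c t)}` for `p ∤ c` (`#Ω_p = ρ_g(p)` by
`card_filter_range_dvd_eval_affine`, and `p ∣ g(s + ct) ↔ p ∣ g(s + c (t mod p))`) and `Ω_p = ∅` for
`p ∣ c`; the interval sieve with `z = L = u` counts the latter set. [cite: Shiu1980, Lemma 2] -/
theorem card_fiber_sifted_le {D : ℕ} {C₀ : ℝ}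
    (hFL : ∀ (X : ℕ) (Ω : ℕ → Finset ℕ),
      (∀ p : ℕ, p.Prime → ∀ r ∈ Ω p, r < p) → (∀ p : ℕ, p.Prime → #(Ω p) ≤ D) →
      (∀ p : ℕ, p.Prime → #(Ω p) < p) →
      ∀ z L : ℝ, 2 ≤ z → z ≤ L →
        |(#{n ∈ Icc 1 X | ∀ p ∈ Nat.primesBelow ⌈z⌉₊, n % p ∉ Ω p} : ℝ) -
            X * ∏ p ∈ Nat.primesBelow ⌈z⌉₊, (1 - (#(Ω p) : ℝ) / p)| ≤
          C₀ * X * (∏ p ∈ Nat.primesBelow ⌈z⌉₊, (1 - (#(Ω p) : ℝ) / p)) *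
              Real.exp (-(Real.log L / Real.log z)) + L ^ 2)
    (hC₀ : 0 ≤ C₀) (g : ℤ[X]) (hD : ∀ p : ℕ, p.Prime → polyRootCountMod ![g] p ≤ D)
    (hfix : ∀ p : ℕ, p.Prime → polyRootCountMod ![g] p < p) (c s N : ℕ)
    {u : ℝ} (hu : 2 ≤ u) :
    (#((Icc 1 N).filter fun n : ℕ => n % c = s ∧
        ∀ p ∈ Nat.primesBelow ⌈u⌉₊, ¬ p ∣ c → ¬ (p : ℤ) ∣ g.eval (n : ℤ)) : ℝ) ≤
      (1 + C₀) * ((N : ℝ) / c) * ∏ p ∈ (Nat.primesBelow ⌈u⌉₊).filter (fun p => ¬ p ∣ c),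
          (1 - (polyRootCountMod ![g] p : ℝ) / p) + u ^ 2 + 1 := by
  classical
  set PB := Nat.primesBelow ⌈u⌉₊ with hPB
  set T := N / c with hT
  set Ω : ℕ → Finset ℕ := fun p => if p ∣ c then ∅ else
      (range p).filter fun t : ℕ => (p : ℤ) ∣ g.eval ((s : ℤ) + c * t) with hΩ
  have hΩdvd : ∀ p : ℕ, p ∣ c → Ω p = ∅ := fun p hpc => by simp only [hΩ, hpc, if_true]
  have hΩndvd : ∀ p : ℕ, ¬ p ∣ c →
      Ω p = (range p).filter fun t : ℕ => (p : ℤ) ∣ g.eval ((s : ℤ) + c * t) := fun p hpc => by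
    simp only [hΩ, hpc, if_false]
  have hΩlt : ∀ p : ℕ, p.Prime → ∀ r ∈ Ω p, r < p := by
    intro p _ r hr
    by_cases hpc : p ∣ c
    · rw [hΩdvd p hpc] at hr
      exact absurd hr (Finset.notMem_empty r)
    · rw [hΩndvd p hpc, mem_filter, mem_range] at hr
      exact hr.1
  have hΩcard : ∀ p : ℕ, p.Prime → ¬ p ∣ c → #(Ω p) = polyRootCountMod ![g] p := by
    intro p hp hpc
    rw [hΩndvd p hpc]
    exact card_filter_range_dvd_eval_affine g hp hpc s
  have hΩcard' : ∀ p : ℕ, p ∣ c → #(Ω p) = 0 := fun p hpc => by rw [hΩdvd p hpc, card_empty]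
  have hΩD : ∀ p : ℕ, p.Prime → #(Ω p) ≤ D := by
    intro p hp
    by_cases hpc : p ∣ c
    · rw [hΩcard' p hpc]; exact Nat.zero_le _
    · rw [hΩcard p hp hpc]; exact hD p hp
  have hΩp : ∀ p : ℕ, p.Prime → #(Ω p) < p := by
    intro p hp
    by_cases hpc : p ∣ c
    · rw [hΩcard' p hpc]; exact hp.pos
    · rw [hΩcard p hp hpc]; exact hfix p hp
  -- the interval sieve on `[1, T]` with `z = L = u`
  have hF := hFL T Ω hΩlt hΩD hΩp u u hu le_rfl
  have hV : ∏ p ∈ PB, (1 - (#(Ω p) : ℝ) / p) =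
      ∏ p ∈ PB.filter (fun p => ¬ p ∣ c), (1 - (polyRootCountMod ![g] p : ℝ) / p) := by
    rw [prod_filter]
    refine prod_congr rfl fun p hp => ?_
    have hpp : p.Prime := (Nat.mem_primesBelow.1 hp).2
    by_cases hpc : p ∣ c
    · rw [if_neg (not_not_intro hpc), hΩcard' p hpc]
      simp
    · rw [if_pos hpc, hΩcard p hpp hpc]
  have hVnn : 0 ≤ ∏ p ∈ PB, (1 - (#(Ω p) : ℝ) / p) := by
    refine prod_nonneg fun p hp => ?_
    have hpp : p.Prime := (Nat.mem_primesBelow.1 hp).2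
    have h1 : (#(Ω p) : ℝ) < p := by exact_mod_cast hΩp p hpp
    have hp0 : (0 : ℝ) < p := by exact_mod_cast hpp.pos
    rw [sub_nonneg, div_le_one hp0]
    exact h1.le
  have hlogu : 0 < Real.log u := Real.log_pos (by linarith)
  have hexp : Real.exp (-(Real.log u / Real.log u)) ≤ 1 := by
    rw [div_self hlogu.ne']
    exact Real.exp_le_one_iff.2 (by norm_num)
  have hcount : (#{t ∈ Icc 1 T | ∀ p ∈ PB, t % p ∉ Ω p} : ℝ) ≤
      (1 + C₀) * T * ∏ p ∈ PB, (1 - (#(Ω p) : ℝ) / p) + u ^ 2 := by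
    have h1 := (abs_le.1 hF).2
    have h0 : 0 ≤ C₀ * T * ∏ p ∈ PB, (1 - (#(Ω p) : ℝ) / p) := by positivity
    have h2 : C₀ * T * (∏ p ∈ PB, (1 - (#(Ω p) : ℝ) / p)) * Real.exp (-(Real.log u / Real.log u))
        ≤ C₀ * T * ∏ p ∈ PB, (1 - (#(Ω p) : ℝ) / p) :=
      (mul_le_mul_of_nonneg_left hexp h0).trans (le_of_eq (mul_one _))
    linarith
  -- the injection `n ↦ ⌊n / c⌋`
  set Scl := (Icc 1 N).filter fun n : ℕ => n % c = s ∧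
      ∀ p ∈ PB, ¬ p ∣ c → ¬ (p : ℤ) ∣ g.eval (n : ℤ) with hScl
  have hmap : ∀ n ∈ Scl, n / c ∈ insert 0 {t ∈ Icc 1 T | ∀ p ∈ PB, t % p ∉ Ω p} := by
    intro n hn
    rw [hScl, mem_filter, mem_Icc] at hn
    obtain ⟨⟨-, hnN⟩, hns, hsift⟩ := hn
    rw [mem_insert]
    by_cases h0 : n / c = 0
    · exact Or.inl h0
    refine Or.inr (mem_filter.2 ⟨mem_Icc.2 ⟨Nat.pos_of_ne_zero h0, Nat.div_le_div_right hnN⟩, ?_⟩)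
    intro p hp hmem
    have hpp : p.Prime := (Nat.mem_primesBelow.1 hp).2
    by_cases hpc : p ∣ c
    · rw [hΩdvd p hpc] at hmem
      exact Finset.notMem_empty _ hmem
    rw [hΩndvd p hpc, mem_filter] at hmem
    apply hsift p hp hpc
    have hn_eq : (n : ℤ) = (s : ℤ) + c * (n / c : ℕ) := by
      have h := Nat.mod_add_div n c
      rw [hns] at h
      exact_mod_cast h.symm
    rw [hn_eq]
    set G : ℤ[X] := g.comp (C (s : ℤ) + C (c : ℤ) * X) with hG
    have hGev : ∀ t : ℕ, G.eval (t : ℤ) = g.eval ((s : ℤ) + c * t) := by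
      intro t
      simp [hG, eval_comp]
    have key := (dvd_eval_iff_dvd_eval_mod G p (n / c)).2
    rw [hGev, hGev] at key
    exact key hmem.2
  have hinj : Set.InjOn (fun n : ℕ => n / c) (Scl : Set ℕ) := by
    intro n hn m hm h
    have hn' : n % c = s := (mem_filter.1 (mem_coe.1 hn)).2.1
    have hm' : m % c = s := (mem_filter.1 (mem_coe.1 hm)).2.1
    have h' : n / c = m / c := h
    calc n = n % c + c * (n / c) := (Nat.mod_add_div n c).symm
      _ = m % c + c * (m / c) := by rw [hn', hm', h']
      _ = m := Nat.mod_add_div m c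
  have hcard : #Scl ≤ #{t ∈ Icc 1 T | ∀ p ∈ PB, t % p ∉ Ω p} + 1 :=
    (card_le_card_of_injOn (fun n : ℕ => n / c) hmap hinj).trans (card_insert_le _ _)
  have hcardR : (#Scl : ℝ) ≤ #{t ∈ Icc 1 T | ∀ p ∈ PB, t % p ∉ Ω p} + 1 := by
    exact_mod_cast hcard
  have hTle : (T : ℝ) ≤ (N : ℝ) / c := Nat.cast_div_le
  have hmono : (1 + C₀) * T * ∏ p ∈ PB, (1 - (#(Ω p) : ℝ) / p) ≤
      (1 + C₀) * ((N : ℝ) / c) * ∏ p ∈ PB, (1 - (#(Ω p) : ℝ) / p) := by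
    refine mul_le_mul_of_nonneg_right ?_ hVnn
    exact mul_le_mul_of_nonneg_left hTle (by linarith)
  rw [← hV]
  linarith

/-! ### The sifted polynomial progression -/

/-- **The sifted polynomial progression** (polynomial analogue of Shiu's Lemma 2; the sieve input of
Erdős 1952 / Nair 1992 for one polynomial).  For every `D` there is `C = C(D) > 0` such that for every
`g ∈ ℤ[X]` with `ρ_g(p) ≤ D` and `ρ_g(p) < p` at every prime, every `c ≥ 1`, every `N` and every
real `u ≥ 2`:
`#{1 ≤ n ≤ N : c ∣ g(n), p ∤ g(n) for all primes p < u with p ∤ c}`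
`≤ C · ρ_g(c) · ((N/c + 1) · ∏_{p<u, p∤c} (1 − ρ_g(p)/p) + u²)`.
Proof: split into the `ρ_g(c)` root classes `n ≡ s (mod c)` (`c ∣ g(n) ↔ c ∣ g(n mod c)`) and apply
`card_fiber_sifted_le` (interval sieve `IntervalClassSieve.abs_card_sub_le`, `C = 2 + C_FL(D)`).
[cite: Shiu1980, Lemma 2] [cite: HalberstamRichert1974, Thm 2.5] -/
theorem polySegment_sieve_bound (D : ℕ) :
    ∃ C : ℝ, 0 < C ∧ ∀ (g : ℤ[X]), (∀ p : ℕ, p.Prime → polyRootCountMod ![g] p ≤ D) →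
      (∀ p : ℕ, p.Prime → polyRootCountMod ![g] p < p) →
      ∀ (c : ℕ), 0 < c → ∀ (N : ℕ) (u : ℝ), 2 ≤ u →
        (#((Icc 1 N).filter fun n : ℕ => (c : ℤ) ∣ g.eval (n : ℤ) ∧
            ∀ p ∈ Nat.primesBelow ⌈u⌉₊, ¬ p ∣ c → ¬ (p : ℤ) ∣ g.eval (n : ℤ)) : ℝ) ≤
          C * polyRootCountMod ![g] c *
            (((N : ℝ) / c + 1) * ∏ p ∈ (Nat.primesBelow ⌈u⌉₊).filter (fun p => ¬ p ∣ c),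
                (1 - (polyRootCountMod ![g] p : ℝ) / p) + u ^ 2) := by
  obtain ⟨C₀, hC₀, hFL⟩ := IntervalClassSieve.abs_card_sub_le D
  refine ⟨2 + C₀, by linarith, fun g hD hfix c hc N u hu => ?_⟩
  classical
  set PB := Nat.primesBelow ⌈u⌉₊ with hPB
  set S := (Icc 1 N).filter fun n : ℕ => (c : ℤ) ∣ g.eval (n : ℤ) ∧
      ∀ p ∈ PB, ¬ p ∣ c → ¬ (p : ℤ) ∣ g.eval (n : ℤ) with hS
  set R := (range c).filter fun s : ℕ => (c : ℤ) ∣ g.eval (s : ℤ) with hR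
  set V := ∏ p ∈ PB.filter (fun p => ¬ p ∣ c), (1 - (polyRootCountMod ![g] p : ℝ) / p)
    with hVdef
  have hRcard : #R = polyRootCountMod ![g] c := (polyRootCountMod_single g c).symm
  have hfib : #S = ∑ s ∈ R, #{n ∈ S | n % c = s} := by
    refine card_eq_sum_card_fiberwise fun n hn => ?_
    have hn' : n ∈ S := mem_coe.1 hn
    rw [hS, mem_filter] at hn'
    exact mem_coe.2 (mem_filter.2
      ⟨mem_range.2 (Nat.mod_lt _ hc), (dvd_eval_iff_dvd_eval_mod g c n).1 hn'.2.1⟩)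
  have hVnn : 0 ≤ V := prod_nonneg fun p hp => by
    have hpp : p.Prime := (Nat.mem_primesBelow.1 (mem_filter.1 hp).1).2
    have h1 : (polyRootCountMod ![g] p : ℝ) < p := by exact_mod_cast hfix p hpp
    have hp0 : (0 : ℝ) < p := by exact_mod_cast hpp.pos
    rw [sub_nonneg, div_le_one hp0]
    exact h1.le
  have hbound : ∀ s ∈ R, (#{n ∈ S | n % c = s} : ℝ) ≤
      (1 + C₀) * ((N : ℝ) / c) * V + u ^ 2 + 1 := by
    intro s _
    have hsub : {n ∈ S | n % c = s} ⊆ (Icc 1 N).filter (fun n : ℕ => n % c = s ∧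
        ∀ p ∈ PB, ¬ p ∣ c → ¬ (p : ℤ) ∣ g.eval (n : ℤ)) := by
      intro n hn
      rw [mem_filter, hS, mem_filter] at hn
      exact mem_filter.2 ⟨hn.1.1, hn.2, hn.1.2.2⟩
    have h1 : (#{n ∈ S | n % c = s} : ℝ) ≤ #((Icc 1 N).filter (fun n : ℕ => n % c = s ∧
        ∀ p ∈ PB, ¬ p ∣ c → ¬ (p : ℤ) ∣ g.eval (n : ℤ))) := by
      exact_mod_cast card_le_card hsub
    exact h1.trans (card_fiber_sifted_le hFL hC₀.le g hD hfix c s N hu)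
  have hρ : (0 : ℝ) ≤ polyRootCountMod ![g] c := Nat.cast_nonneg _
  have hNc : (0 : ℝ) ≤ (N : ℝ) / c := by positivity
  have hu2 : (1 : ℝ) ≤ u ^ 2 := by nlinarith
  have hkey : (1 + C₀) * ((N : ℝ) / c) * V + u ^ 2 + 1 ≤
      (2 + C₀) * (((N : ℝ) / c + 1) * V + u ^ 2) := by
    have h1 : 0 ≤ (N : ℝ) / c * V := mul_nonneg hNc hVnn
    have h2 : 0 ≤ C₀ * V := mul_nonneg hC₀.le hVnn
    have h3 : 0 ≤ C₀ * u ^ 2 := mul_nonneg hC₀.le (by positivity)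
    nlinarith
  calc (#S : ℝ) = ∑ s ∈ R, (#{n ∈ S | n % c = s} : ℝ) := by
        rw [hfib]
        push_cast
        rfl
    _ ≤ ∑ s ∈ R, ((1 + C₀) * ((N : ℝ) / c) * V + u ^ 2 + 1) := sum_le_sum hbound
    _ = polyRootCountMod ![g] c * ((1 + C₀) * ((N : ℝ) / c) * V + u ^ 2 + 1) := by
        rw [sum_const, nsmul_eq_mul, hRcard]
    _ ≤ polyRootCountMod ![g] c * ((2 + C₀) * (((N : ℝ) / c + 1) * V + u ^ 2)) :=
        mul_le_mul_of_nonneg_left hkey hρ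
    _ = (2 + C₀) * polyRootCountMod ![g] c * (((N : ℝ) / c + 1) * V + u ^ 2) := by ring

/-! ### The split form of the sieve product -/

/-- Without a fixed prime divisor, `0 < 1 − ρ_g(p)/p ≤ 1` at every prime. [folklore] -/
theorem one_sub_rho_div_pos_le_one {g : ℤ[X]} (hfix : ∀ p : ℕ, p.Prime → polyRootCountMod ![g] p < p)
    {p : ℕ} (hp : p.Prime) :
    0 < 1 - (polyRootCountMod ![g] p : ℝ) / p ∧ 1 - (polyRootCountMod ![g] p : ℝ) / p ≤ 1 := by
  have hp0 : (0 : ℝ) < p := by exact_mod_cast hp.pos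
  have h1 : (polyRootCountMod ![g] p : ℝ) < p := by exact_mod_cast hfix p hp
  refine ⟨?_, ?_⟩
  · rw [sub_pos, div_lt_one hp0]
    exact h1
  · have : 0 ≤ (polyRootCountMod ![g] p : ℝ) / p := by positivity
    linarith

/-- **Splitting off the primes dividing `c`.**  For `c ≠ 0`,
`∏_{p<u, p∤c} (1 − ρ_g(p)/p) ≤ ∏_{p<u} (1 − ρ_g(p)/p) · ∏_{p ∣ c} (1 − ρ_g(p)/p)⁻¹`
(the omitted factors `p < u`, `p ∣ c` form a sub-product of `∏_{p ∣ c}`, all factors in `(0, 1]`).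
[folklore] -/
theorem prod_filter_not_dvd_le {g : ℤ[X]} (hfix : ∀ p : ℕ, p.Prime → polyRootCountMod ![g] p < p)
    {c : ℕ} (hc : c ≠ 0) (u : ℝ) :
    ∏ p ∈ (Nat.primesBelow ⌈u⌉₊).filter (fun p => ¬ p ∣ c),
        (1 - (polyRootCountMod ![g] p : ℝ) / p) ≤
      (∏ p ∈ Nat.primesBelow ⌈u⌉₊, (1 - (polyRootCountMod ![g] p : ℝ) / p)) *
        ∏ p ∈ c.primeFactors, (1 - (polyRootCountMod ![g] p : ℝ) / p)⁻¹ := by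
  set PB := Nat.primesBelow ⌈u⌉₊ with hPB
  set f : ℕ → ℝ := fun p => 1 - (polyRootCountMod ![g] p : ℝ) / p with hf
  have hsplit : (∏ p ∈ PB.filter (fun p => p ∣ c), f p) * ∏ p ∈ PB.filter (fun p => ¬ p ∣ c), f p =
      ∏ p ∈ PB, f p := prod_filter_mul_prod_filter_not PB (fun p => p ∣ c) f
  have hBpos : 0 < ∏ p ∈ PB.filter (fun p => p ∣ c), f p :=
    prod_pos fun p hp => (one_sub_rho_div_pos_le_one hfix (Nat.mem_primesBelow.1 (mem_filter.1 hp).1).2).1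
  have hPFpos : 0 < ∏ p ∈ c.primeFactors, f p :=
    prod_pos fun p hp => (one_sub_rho_div_pos_le_one hfix (Nat.prime_of_mem_primeFactors hp)).1
  have hsub : PB.filter (fun p => p ∣ c) ⊆ c.primeFactors := by
    intro p hp
    rw [mem_filter] at hp
    exact Nat.mem_primeFactors.2 ⟨(Nat.mem_primesBelow.1 hp.1).2, hp.2, hc⟩
  have hle : ∏ p ∈ c.primeFactors, f p ≤ ∏ p ∈ PB.filter (fun p => p ∣ c), f p :=
    prod_le_prod_of_subset_of_le_one hsub
      (fun p hp => (one_sub_rho_div_pos_le_one hfix (Nat.prime_of_mem_primeFactors hp)).1.le)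
      (fun p hp _ => (one_sub_rho_div_pos_le_one hfix (Nat.prime_of_mem_primeFactors hp)).2)
  have hA : ∏ p ∈ PB.filter (fun p => ¬ p ∣ c), f p =
      (∏ p ∈ PB, f p) / ∏ p ∈ PB.filter (fun p => p ∣ c), f p := by
    rw [← hsplit, mul_div_cancel_left₀ _ hBpos.ne']
  have hPBnn : 0 ≤ ∏ p ∈ PB, f p :=
    prod_nonneg fun p hp => (one_sub_rho_div_pos_le_one hfix (Nat.mem_primesBelow.1 hp).2).1.le
  rw [hA, prod_inv_distrib, ← div_eq_mul_inv]
  exact div_le_div_of_nonneg_left hPBnn hPFpos hle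

/-- **The sifted polynomial progression, split form**: with `C = C(D)` as in `polySegment_sieve_bound`,
`#{1 ≤ n ≤ N : c ∣ g(n), p ∤ g(n) ∀ p < u prime, p ∤ c}`
`≤ C · ρ_g(c) · ((N/c + 1) · ∏_{p<u} (1 − ρ_g(p)/p) · ∏_{p ∣ c} (1 − ρ_g(p)/p)⁻¹ + u²)` — the shape
summed over `c` with the multiplicative weight `ρ_g(c) ∏_{p ∣ c}(1 − ρ_g(p)/p)⁻¹ / c` in Shiu's
classes I and IV. [cite: Shiu1980, Lemma 2 and §5] -/
theorem polySegment_sieve_bound' (D : ℕ) :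
    ∃ C : ℝ, 0 < C ∧ ∀ (g : ℤ[X]), (∀ p : ℕ, p.Prime → polyRootCountMod ![g] p ≤ D) →
      (∀ p : ℕ, p.Prime → polyRootCountMod ![g] p < p) →
      ∀ (c : ℕ), 0 < c → ∀ (N : ℕ) (u : ℝ), 2 ≤ u →
        (#((Icc 1 N).filter fun n : ℕ => (c : ℤ) ∣ g.eval (n : ℤ) ∧
            ∀ p ∈ Nat.primesBelow ⌈u⌉₊, ¬ p ∣ c → ¬ (p : ℤ) ∣ g.eval (n : ℤ)) : ℝ) ≤
          C * polyRootCountMod ![g] c *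
            (((N : ℝ) / c + 1) * ((∏ p ∈ Nat.primesBelow ⌈u⌉₊,
                (1 - (polyRootCountMod ![g] p : ℝ) / p)) *
              ∏ p ∈ c.primeFactors, (1 - (polyRootCountMod ![g] p : ℝ) / p)⁻¹) + u ^ 2) := by
  obtain ⟨C, hC, h⟩ := polySegment_sieve_bound D
  refine ⟨C, hC, fun g hD hfix c hc N u hu => (h g hD hfix c hc N u hu).trans ?_⟩
  have hρ : (0 : ℝ) ≤ C * polyRootCountMod ![g] c := by positivity
  refine mul_le_mul_of_nonneg_left ?_ hρ
  have hNc : (0 : ℝ) ≤ (N : ℝ) / c + 1 := by positivity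
  have := mul_le_mul_of_nonneg_left (prod_filter_not_dvd_le hfix hc.ne' u) hNc
  linarith

end ErdosDivisor

end Summit.Parity.BatemanHorn.Theorems
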